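import Literature.Geometry.DiscreteGeometry.ContactGraphBoundaryCycle
import Literature.Geometry.DiscreteGeometry.HarborthConstruction
import HarnessLib

/-!
# Harborth 1974: `B(n) = [3n - √(12n - 3)]` — the named fact discharged

Topic `Literature/Geometry/DiscreteGeometry`. Final file of the proof of Harborth's theorem
[Harborth1974, (5)–(6)] (Reutter's Problem 664A): the named fact
`Harborth1974_contactNumber` of `UnitDiscContactNumber.lean` HOLDS.

* The lower bound (6) — hexagonal spiral configurations with exactly `[3n - √(12n - 3)]` contact
  pairs — is `exists_contactPairCount_eq_harborthNumber` (`HarborthConstruction.lean`), packaged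
  there as `harborth1974_contactNumber_of_upperBound`.
* The upper bound (5) for centre sets `P : Finset ℂ` is `Harborth.card_darts_le`
  (`ContactGraphBoundaryCycle.lean`): `#darts P ≤ 2 [3n - √(12n - 3)]`, proved along Harborth's
  lines — every disc touches at most six others, the boundary polygon of a non-splitting
  configuration is a simple closed `a`-gon whose interior angle at a vertex of degree `j` is
  `≥ (j - 1)π/3` (inequality (2), via Hopf's Umlaufsatz), peeling the boundary and induction with
  the quadratic closure (`HarborthInduction.lean`); Euler's formula (3)–(4) is replaced by the
  degree bound `≤ 6`, and non-connected / cut-vertex configurations (which Harborth discards by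
  maximality) by superadditivity of `[3n - √(12n - 3)]`.
* Here: the transfer from labelled configurations `Fin N → EuclideanSpace ℝ (Fin 2)` with
  `Pairwise (1 ≤ dist)` (the fact's rendering) to centre sets in `ℂ`
  (`contactPairCount_le_harborthNumber`), and `Harborth1974_contactNumber_holds`.
-/

noncomputable section

namespace Literature.Geometry.DiscreteGeometry

open Complex Finset Metric

/-- **Harborth 1974, (5)**: every hard configuration of `N` unit-diameter discs in the plane has
at most `[3N - √(12N - 3)]` contact pairs. (Transfer of `Harborth.card_darts_le` along the
isometry `EuclideanSpace ℝ (Fin 2) ≃ ℂ`: the centre set has `N` points, is hard, and carries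
`2 · contactPairCount` darts.) [cite: Harborth1974, (5)] -/
theorem contactPairCount_le_harborthNumber {N : ℕ} (x : Fin N → EuclideanSpace ℝ (Fin 2))
    (hx : Pairwise fun i j => 1 ≤ dist (x i) (x j)) :
    (contactPairCount x : ℤ) ≤ harborthNumber N := by
  classical
  -- move to `ℂ`
  let e : EuclideanSpace ℝ (Fin 2) ≃ₗᵢ[ℝ] ℂ := Complex.orthonormalBasisOneI.repr.symm
  let y : Fin N → ℂ := fun i => e (x i)
  have hdist : ∀ i j, dist (y i) (y j) = dist (x i) (x j) := fun i j => e.dist_map (x i) (x j)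
  have hyinj : Function.Injective y := by
    intro i j h
    by_contra hij
    have h1 : 1 ≤ dist (x i) (x j) := hx hij
    rw [← hdist, h, dist_self] at h1
    exact absurd h1 (by norm_num)
  let P : Finset ℂ := Finset.univ.image y
  have hmem : ∀ i, y i ∈ P := fun i => Finset.mem_image_of_mem y (Finset.mem_univ i)
  have hcard : P.card = N := by
    rw [Finset.card_image_of_injective _ hyinj, Finset.card_univ, Fintype.card_fin]
  have hhard : Harborth.IsHard P := by
    intro p hp q hq hpq
    obtain ⟨i, -, rfl⟩ := Finset.mem_image.1 hp
    obtain ⟨j, -, rfl⟩ := Finset.mem_image.1 hq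
    have hij : j ≠ i := fun h => hpq (by rw [h])
    rw [← dist_eq_norm, hdist]
    exact hx hij
  -- Harborth's bound for the centre set
  have hD := Harborth.card_darts_le P hhard
  rw [hcard] at hD
  -- the centre set carries `2 · contactPairCount x` darts
  set A := Finset.univ.filter fun p : Fin N × Fin N => p.1 < p.2 ∧ dist (x p.1) (x p.2) = 1
    with hA
  have hAc : A.card = contactPairCount x := rfl
  let f : Fin N × Fin N → ℂ × ℂ := fun ij => (y ij.1, y ij.2)
  have hfinj : Function.Injective f := by
    intro a b h
    have h' := Prod.mk.inj h
    exact Prod.ext (hyinj h'.1) (hyinj h'.2)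
  have hdisj : Disjoint A (A.image Prod.swap) := by
    rw [Finset.disjoint_left]
    intro p hp hp'
    obtain ⟨q, hq, hqp⟩ := Finset.mem_image.1 hp'
    rw [hA, Finset.mem_filter] at hp hq
    rw [← hqp, Prod.fst_swap, Prod.snd_swap] at hp
    exact lt_asymm hp.2.1 hq.2.1
  have hsub : (A ∪ A.image Prod.swap).image f ⊆ Harborth.darts P := by
    intro d hd
    obtain ⟨p, hp, rfl⟩ := Finset.mem_image.1 hd
    have h1 : dist (x p.1) (x p.2) = 1 := by
      rcases Finset.mem_union.1 hp with h | h
      · exact (Finset.mem_filter.1 h).2.2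
      · obtain ⟨q, hq, rfl⟩ := Finset.mem_image.1 h
        rw [Prod.fst_swap, Prod.snd_swap, dist_comm]
        exact (Finset.mem_filter.1 hq).2.2
    refine Harborth.mem_darts.2 ⟨⟨hmem _, hmem _⟩, ?_⟩
    change ‖y p.2 - y p.1‖ = 1
    rw [← dist_eq_norm, hdist, dist_comm, h1]
  have h2 : 2 * contactPairCount x ≤ (Harborth.darts P).card := by
    calc 2 * contactPairCount x = (A ∪ A.image Prod.swap).card := by
          rw [Finset.card_union_of_disjoint hdisj,
            Finset.card_image_of_injective _ Prod.swap_injective, hAc]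
          ring
      _ = ((A ∪ A.image Prod.swap).image f).card := (Finset.card_image_of_injective _ hfinj).symm
      _ ≤ (Harborth.darts P).card := Finset.card_le_card hsub
  have h2' : (2 * contactPairCount x : ℤ) ≤ ((Harborth.darts P).card : ℤ) := by exact_mod_cast h2
  linarith

/-- **Harborth's theorem (1974; Reutter's Problem 664A) holds: the maximal number of contact
points of `n` congruent non-overlapping discs in the plane is `[3n - √(12n - 3)]`.** Discharge of
the named fact `Harborth1974_contactNumber`: the upper bound (5) is
`contactPairCount_le_harborthNumber`, the sharpness (6) is
`exists_contactPairCount_eq_harborthNumber`. [cite: Harborth1974, (5)–(6)] -/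
theorem Harborth1974_contactNumber_holds : Harborth1974_contactNumber :=
  harborth1974_contactNumber_of_upperBound fun _ x hx => contactPairCount_le_harborthNumber x hx

end Literature.Geometry.DiscreteGeometry

end
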